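import Literature.NumberTheory.LFunctions.ClassGroupExplicitFormulaBounds
import HarnessLib

/-!
# The smoothed explicit formula for `ζ_K` against the Thorner–Zaman weight, read ONE-SIDEDLY from
# below, with the (at most one) exceptional zero kept

Topic `Summits/QuantumAdvantage/QuantumAdvantage/Theorems`, helper for the stub
`stub_lowerPIT_of_density` (T5 of line `subgroup-orthogonality-escape`, crux `DegreeOnePrimesEscape`,
stmt-QuantumAdvantage-11543); cell B2b-1 (linnik-cubic), PART A.  HONEST FRAMING: the value of this
file is a THEOREM (kernel-checked lemmas) — not summit progress.

The `ζ_K` twin of `…PerCharacterDeficitSmoothed.lean`.  With `g = tzTest (log x) ε`, `F` its Laplace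
transform and `K_1(g) = Σ_n Λ_K(n) g(log n)` (`coefFordK (cgCoef 1) g 0`), the explicit formula
`coefFordK_one_eq_explicit` reads `K_1(g) = F(−1) − Σ_ρ m(ρ)F(−ρ) − m₀F(0) + J₁(0)`.  Split the
non-trivial zeros of `ζ₁_K` by a predicate "good" = the classical zero-free inequality
`β ≤ 1 − c/(𝓠 + log(|γ| + 4))`; assume (Landau–Page, hypotheses here) that the non-good zeros are
real, simple and pairwise equal, and that the finite partial sums `Σ_{good} m‖F(−ρ)‖` are `≤ B`
(`…LowerPITZeroSum`).  Then (`re_coefFordK_one_tzTest_dichotomy`), with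
`R = B + m₀ (L + ε) + ‖J₁(0)‖`:

* either `Re K_1(g) ≥ ∫_{L/2}^{L} e^u du − R` (no exceptional zero),
* or there is a real zero `β₁ ∈ (0,1)` of `ζ₁_K`, not good, with
  `Re K_1(g) ≥ ∫_{L/2}^{L} (e^u − e^{β₁ u}) du − R`
  (main term and exceptional term compared through `TZWeight.fordLaplace_tzTest_real_sub_mem`).
-/

noncomputable section

open Complex Real MeasureTheory Set Filter Topology
open scoped NumberField nonZeroDivisors
open Literature.NumberTheory.LFunctions Literature.NumberTheory.LFunctions.NumberField
  Literature.NumberTheory.LFunctions.EntireEF Literature.NumberTheory.LFunctions.TZWeight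

namespace Summit.QuantumAdvantage.QuantumAdvantage.Theorems.DegreeOnePrimesEscape

variable {K : Type} [Field K] [NumberField K]

set_option maxHeartbeats 800000 in
/-- **The explicit formula for `ζ_K` read from below, exceptional zero kept** (see the module
docstring): for `x > 1`, `0 < ε < (log x)/2`, parameters `c, 𝓠` of the predicate
`good ρ := Re ρ ≤ 1 − c/(𝓠 + log(|Im ρ| + 4))`, Landau–Page hypotheses for the non-good non-trivial zeros
of `ζ₁_K` (real, pairwise equal, simple) and a bound `B` for the finite partial sums of `m(ρ)‖F(−ρ)‖`
over good zeros: with `R = B + m₀(log x + ε) + ‖J₁(0)‖`, either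
`∫_{L/2}^{L} e^u du − R ≤ Re K_1(g)`, or some real non-good zero `β₁ ∈ (0,1)` of `ζ₁_K` has
`∫_{L/2}^{L} (e^u − e^{β₁u}) du − R ≤ Re K_1(g)`. -/
theorem re_coefFordK_one_tzTest_dichotomy {x ε : ℝ} (hx : 1 < x) (hε : 0 < ε) (hεL : ε < Real.log x / 2)
    (c 𝓠 : ℝ)
    (hreal : ∀ ρ : ℂ, dedekindZeta₁ K ρ = 0 → 0 < ρ.re → ρ.re < 1 →
      ¬ ρ.re ≤ 1 - c / (𝓠 + Real.log (|ρ.im| + 4)) → ρ.im = 0)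
    (huniq : ∀ ρ₁ ρ₂ : ℂ, dedekindZeta₁ K ρ₁ = 0 → 0 < ρ₁.re → ρ₁.re < 1 →
      ¬ ρ₁.re ≤ 1 - c / (𝓠 + Real.log (|ρ₁.im| + 4)) →
      dedekindZeta₁ K ρ₂ = 0 → 0 < ρ₂.re → ρ₂.re < 1 →
      ¬ ρ₂.re ≤ 1 - c / (𝓠 + Real.log (|ρ₂.im| + 4)) → ρ₁ = ρ₂)
    (hsimple : ∀ ρ : ℂ, dedekindZeta₁ K ρ = 0 → 0 < ρ.re → ρ.re < 1 →
      ¬ ρ.re ≤ 1 - c / (𝓠 + Real.log (|ρ.im| + 4)) → analyticOrderNatAt (dedekindZeta₁ K) ρ = 1)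
    {B : ℝ}
    (hB : ∀ u : Finset ℂ, (∀ ρ ∈ u, dedekindZeta₁ K ρ = 0 ∧ 0 < ρ.re ∧ ρ.re < 1) →
      ∑ ρ ∈ u with ρ.re ≤ 1 - c / (𝓠 + Real.log (|ρ.im| + 4)),
        (analyticOrderNatAt (dedekindZeta₁ K) ρ : ℝ) * ‖fordLaplace (tzTest (Real.log x) ε) (-ρ)‖ ≤ B) :
    ((∫ u in (Real.log x / 2)..Real.log x, Real.exp u) -
        (B + (analyticOrderNatAt (dedekindZeta₁ K) 0 : ℝ) * (Real.log x + ε) +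
          ‖dzEFRemainder K (tzTest (Real.log x) ε) 0‖) ≤
        (coefFordK (cgCoef (1 : ClassGroup (𝓞 K) →* ℂˣ)) (tzTest (Real.log x) ε) 0).re) ∨
    ∃ β₁ : ℝ, dedekindZeta₁ K β₁ = 0 ∧ 0 < β₁ ∧ β₁ < 1 ∧
      ¬ β₁ ≤ 1 - c / (𝓠 + Real.log (|(0 : ℝ)| + 4)) ∧
      (∫ u in (Real.log x / 2)..Real.log x, (Real.exp u - Real.exp (β₁ * u))) -
        (B + (analyticOrderNatAt (dedekindZeta₁ K) 0 : ℝ) * (Real.log x + ε) +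
          ‖dzEFRemainder K (tzTest (Real.log x) ε) 0‖) ≤
        (coefFordK (cgCoef (1 : ClassGroup (𝓞 K) →* ℂˣ)) (tzTest (Real.log x) ε) 0).re := by
  classical
  set Lx := Real.log x with hLx
  have hL : 0 < Lx := Real.log_pos hx
  have hadm := isSmoothedEFTest_tzTest hL hε
  have hg0 : tzTest Lx ε 0 = 0 := tzTest_zero hL hε hεL.le
  have hsz : ∀ ρ : ℂ, dedekindZeta₁ K ρ = 0 → 0 < ρ.re → ρ.re < 1 → ρ ≠ 0 := by
    intro ρ _ h1 _ h; rw [h] at h1; simp at h1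
  have hexpl := coefFordK_one_eq_explicit (K := K) hadm hg0 (s := 0) (by norm_num) (by norm_num) hsz
  set good : ℂ → Prop := fun ρ ↦ ρ.re ≤ 1 - c / (𝓠 + Real.log (|ρ.im| + 4)) with hgood
  -- the zero sum
  set a : nontrivialZeros (dedekindZeta₁ K) → ℂ := fun ρ ↦
    (analyticOrderNatAt (dedekindZeta₁ K) (ρ : ℂ) : ℂ) * fordLaplace₀ (tzTest Lx ε) (0 - ρ) with ha
  have hsum : Summable (fun ρ ↦ ‖a ρ‖) :=
    summable_norm_dzZeroTerm (K := K) hadm (s := 0) (by norm_num) hsz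
  have hsum' : Summable a := hsum.of_norm
  have ha_eq : ∀ ρ : nontrivialZeros (dedekindZeta₁ K),
      ‖a ρ‖ = (analyticOrderNatAt (dedekindZeta₁ K) (ρ : ℂ) : ℝ) * ‖fordLaplace (tzTest Lx ε) (-(ρ : ℂ))‖ := by
    intro ρ
    rw [ha]; dsimp only
    rw [zero_sub, fordLaplace₀_eq_fordLaplace hg0, norm_mul, Complex.norm_natCast]
  -- the majorant over good zeros
  set b : nontrivialZeros (dedekindZeta₁ K) → ℝ := fun ρ ↦ if good (ρ : ℂ) then ‖a ρ‖ else 0 with hb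
  have hb0 : ∀ ρ, 0 ≤ b ρ := fun ρ ↦ by rw [hb]; dsimp only; split_ifs <;> positivity
  have hble : ∀ ρ, b ρ ≤ ‖a ρ‖ := fun ρ ↦ by
    rw [hb]; dsimp only; split_ifs
    · exact le_rfl
    · exact norm_nonneg _
  have hbsum : Summable b := Summable.of_nonneg_of_le hb0 hble hsum
  have hbB : ∑' ρ, b ρ ≤ B := by
    refine hbsum.tsum_le_of_sum_le fun s ↦ ?_
    have hinj : Set.InjOn (Subtype.val : nontrivialZeros (dedekindZeta₁ K) → ℂ) ↑s :=
      fun a _ b _ h ↦ Subtype.ext h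
    have hBs := hB (s.image Subtype.val) (fun ρ hρ ↦ ?_)
    · refine le_trans (le_of_eq ?_) hBs
      rw [Finset.sum_filter, Finset.sum_image hinj]
      refine Finset.sum_congr rfl fun ρ _ ↦ ?_
      rw [hb]; dsimp only
      by_cases hgd : good (ρ : ℂ)
      · rw [if_pos hgd, if_pos hgd, ha_eq]
      · rw [if_neg hgd, if_neg hgd]
    · obtain ⟨ρ', _, rfl⟩ := Finset.mem_image.1 hρ
      exact ρ'.2
  -- `m₀ F(0)` and `J`
  have hF0 : ‖fordLaplace₀ (tzTest Lx ε) 0‖ ≤ Lx + ε := by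
    rw [fordLaplace₀_eq_fordLaplace hg0]; exact norm_fordLaplace_tzTest_zero_le hL hε hεL
  have h2 : ((analyticOrderNatAt (dedekindZeta₁ K) 0 : ℂ) * fordLaplace₀ (tzTest Lx ε) 0).re ≤
      (analyticOrderNatAt (dedekindZeta₁ K) 0 : ℝ) * (Lx + ε) := by
    calc ((analyticOrderNatAt (dedekindZeta₁ K) 0 : ℂ) * fordLaplace₀ (tzTest Lx ε) 0).re
        ≤ ‖(analyticOrderNatAt (dedekindZeta₁ K) 0 : ℂ) * fordLaplace₀ (tzTest Lx ε) 0‖ :=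
          Complex.re_le_norm _
      _ = (analyticOrderNatAt (dedekindZeta₁ K) 0 : ℝ) * ‖fordLaplace₀ (tzTest Lx ε) 0‖ := by
          rw [norm_mul, Complex.norm_natCast]
      _ ≤ _ := mul_le_mul_of_nonneg_left hF0 (Nat.cast_nonneg _)
  have h3 : -‖dzEFRemainder K (tzTest Lx ε) 0‖ ≤ (dzEFRemainder K (tzTest Lx ε) 0).re :=
    (abs_le.1 (Complex.abs_re_le_norm (dzEFRemainder K (tzTest Lx ε) 0))).1
  -- the main term `F(−1)`: `fordLaplace₀ g (0 − 1) = fordLaplace g (−1)`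
  have hmainF : fordLaplace₀ (tzTest Lx ε) (0 - 1) = fordLaplace (tzTest Lx ε) (-(1 : ℂ)) := by
    rw [zero_sub, fordLaplace₀_eq_fordLaplace hg0]
  -- the real part of `K`
  have hreK : (coefFordK (cgCoef (1 : ClassGroup (𝓞 K) →* ℂˣ)) (tzTest Lx ε) 0).re =
      (fordLaplace (tzTest Lx ε) (-(1 : ℂ))).re - (∑' ρ, a ρ).re -
        ((analyticOrderNatAt (dedekindZeta₁ K) 0 : ℂ) * fordLaplace₀ (tzTest Lx ε) 0).re +
          (dzEFRemainder K (tzTest Lx ε) 0).re := by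
    rw [hexpl, hmainF]
    simp only [Complex.sub_re, Complex.add_re]
  by_cases hbad : ∃ ρ₁ : nontrivialZeros (dedekindZeta₁ K), ¬ good (ρ₁ : ℂ)
  · -- Case 2: an exceptional zero `ρ₁ = β₁`, real and simple; all other zeros are good
    obtain ⟨ρ₁, hρ₁⟩ := hbad
    have hρ₁Z : dedekindZeta₁ K ρ₁ = 0 ∧ 0 < (ρ₁ : ℂ).re ∧ (ρ₁ : ℂ).re < 1 := ρ₁.2
    have him : (ρ₁ : ℂ).im = 0 := hreal _ hρ₁Z.1 hρ₁Z.2.1 hρ₁Z.2.2 hρ₁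
    have hm1 : analyticOrderNatAt (dedekindZeta₁ K) (ρ₁ : ℂ) = 1 :=
      hsimple _ hρ₁Z.1 hρ₁Z.2.1 hρ₁Z.2.2 hρ₁
    set β₁ : ℝ := (ρ₁ : ℂ).re with hβ₁
    have hρ₁eq : (ρ₁ : ℂ) = ((β₁ : ℝ) : ℂ) := by
      apply Complex.ext <;> simp [hβ₁, him]
    right
    refine ⟨β₁, by rw [← hρ₁eq]; exact hρ₁Z.1, hρ₁Z.2.1, hρ₁Z.2.2, ?_, ?_⟩
    · have : ¬ good (ρ₁ : ℂ) := hρ₁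
      rw [hgood] at this; dsimp only at this
      rwa [him] at this
    -- split the zero sum at `ρ₁`
    have hsplit := hsum'.tsum_eq_add_tsum_ite ρ₁
    set a' : nontrivialZeros (dedekindZeta₁ K) → ℂ := fun ρ ↦ if ρ = ρ₁ then 0 else a ρ with ha'
    have ha'le : ∀ ρ, ‖a' ρ‖ ≤ b ρ := by
      intro ρ
      rw [ha']; dsimp only
      by_cases hρρ : ρ = ρ₁
      · rw [if_pos hρρ, norm_zero]; exact hb0 ρ
      · rw [if_neg hρρ, hb]; dsimp only
        have hgd : good (ρ : ℂ) := by
          by_contra hng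
          exact hρρ (Subtype.ext (huniq _ _ ρ.2.1 ρ.2.2.1 ρ.2.2.2 hng hρ₁Z.1 hρ₁Z.2.1 hρ₁Z.2.2 hρ₁))
        rw [if_pos hgd]
    have ha'sum : Summable (fun ρ ↦ ‖a' ρ‖) := Summable.of_nonneg_of_le (fun _ ↦ norm_nonneg _) ha'le hbsum
    have hrest : (∑' ρ, a' ρ).re ≤ B := by
      have h1 : (∑' ρ, a' ρ).re ≤ ‖∑' ρ, a' ρ‖ := Complex.re_le_norm _
      have h2 : ‖∑' ρ, a' ρ‖ ≤ ∑' ρ, ‖a' ρ‖ := norm_tsum_le_tsum_norm ha'sum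
      have h3 : ∑' ρ, ‖a' ρ‖ ≤ ∑' ρ, b ρ := ha'sum.tsum_le_tsum ha'le hbsum
      linarith
    -- `a ρ₁ = F(−β₁)`
    have haρ₁ : a ρ₁ = fordLaplace (tzTest Lx ε) (-((β₁ : ℝ) : ℂ)) := by
      rw [ha]; dsimp only
      rw [hm1, Nat.cast_one, one_mul, zero_sub, fordLaplace₀_eq_fordLaplace hg0, hρ₁eq]
    have hS : (∑' ρ, a ρ).re = (fordLaplace (tzTest Lx ε) (-((β₁ : ℝ) : ℂ))).re + (∑' ρ, a' ρ).re := by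
      rw [hsplit, Complex.add_re, haρ₁]
    -- main minus exceptional
    have hdiff := (fordLaplace_tzTest_real_sub_mem hL hε hεL (le_of_lt hρ₁Z.2.2)).1
    rw [Complex.sub_re] at hdiff
    rw [hreK, hS]
    linarith [hdiff, hrest, h2, h3]
  · -- Case 1: every non-trivial zero is good
    simp only [not_exists, not_not] at hbad
    left
    have hall : ∀ ρ, ‖a ρ‖ ≤ b ρ := by
      intro ρ; rw [hb]; dsimp only; rw [if_pos (hbad ρ)]
    have hrest : (∑' ρ, a ρ).re ≤ B := by
      have h1 : (∑' ρ, a ρ).re ≤ ‖∑' ρ, a ρ‖ := Complex.re_le_norm _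
      have h2 : ‖∑' ρ, a ρ‖ ≤ ∑' ρ, ‖a ρ‖ := norm_tsum_le_tsum_norm hsum
      have h3 : ∑' ρ, ‖a ρ‖ ≤ ∑' ρ, b ρ := hsum.tsum_le_tsum hall hbsum
      linarith
    have hmain := (fordLaplace_tzTest_real_mem hL hε hεL 1).1
    simp only [one_mul, Complex.ofReal_one] at hmain
    rw [hreK]
    linarith [hmain, hrest, h2, h3]

end Summit.QuantumAdvantage.QuantumAdvantage.Theorems.DegreeOnePrimesEscape

end
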